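import Summits.NavierStokesRegularity.NavierStokesRegularity.Theorems.SqueezeCycleMustSqueezeSignedBudgetStatic
import Summits.NavierStokesRegularity.NavierStokesRegularity.Theorems.SqueezeCycleMustSqueezeSimDictionary
import Summits.NavierStokesRegularity.NavierStokesRegularity.Theorems.SqueezeCycleMustSqueezeEndgame
import Summits.NavierStokesRegularity.NavierStokesRegularity.Theorems.SqueezeCycleMustSqueezeGradEnergyBasic
import Summits.NavierStokesRegularity.NavierStokesRegularity.Theorems.SqueezeCycleMustSqueezeGradEnergyAverage
import Summits.NavierStokesRegularity.NavierStokesRegularity.Theorems.SqueezeCycleMustSqueezeDivCurlBalls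
import Summits.NavierStokesRegularity.NavierStokesRegularity.Theorems.SqueezeCycleMustSqueezeTwoPassGronwall
import Summits.NavierStokesRegularity.NavierStokesRegularity.Theorems.SqueezeCycleExtremalBiaxialitySubcriticalOfLiouville
import Summits.NavierStokesRegularity.NavierStokesRegularity.Theorems.SqueezeCycleMustSqueezeAlgebra
import Summits.NavierStokesRegularity.NavierStokesRegularity.Theorems.SqueezeCycleMustSqueezeGronwall
import HarnessLib

/-!
# drefute gen-4 — CURRENT-TREE composition check of line `outward-drift-signed-flux`
  (crux `MustSqueeze`, stmt-NavierStokesRegularity-11610; skeleton v1 sha 75fd2eb7 + sub-stubs)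

State of the tree at 2026-08-16T02:00Z: 6 of the 7 skeleton stubs are LANDED by name
(`Theorems.stub_simDictionary` p71854, `stub_endgame` p72077, `stub_gradEnergyBasic` p72441,
`stub_gradEnergyAverage` p72780, `stub_divCurlBalls` p73424, `stub_twoPassGronwall` p73964) and the
lever's parts 1/3 and 2/3 are LANDED (`stub_signedBudgetFlux` p74308, `stub_signedBudgetStatic` p74592).

This file certifies, against the CURRENT tree (only tree imports; nothing copied from the landed files):
1. `DrefuteG4.hasDerivAt_cutoffEnstrophy`, `enstrophy_identity`, `deriv_cutoffEnstrophy_eq` — the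
   dynamic half (part 3/3), re-proved over the tree's landed helpers (adapted from drefute gen-2's
   `DrefuteG2` section Dynamic, with tree names substituted);
2. `stub_signedBudget_g4` — the skeleton's `stub_signedBudget` VERBATIM, closed from the TREE's
   `stub_signedBudgetStatic` + (1): the landed static part carries exactly the signature the lever needs;
3. `MustSqueeze_of_g4` — the skeleton's `MustSqueeze_of` composition VERBATIM with every stub resolved
   BY NAME to the tree (only `stub_signedBudget ↦ stub_signedBudget_g4`): closes
   `Theses.SqueezeCycle.MustSqueeze`.
So no registered stub of the line is false or misstated; the line's only un-landed obligation is (1)+(2)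
(≈ 230 lines) and the 40-line assembly.
-/

noncomputable section

open MeasureTheory Set Filter Real Metric
open scoped ContDiff RealInnerProductSpace Laplacian
open Literature.Analysis.FluidPDE

set_option linter.dupNamespace false

namespace Summit.NavierStokesRegularity.NavierStokesRegularity.Theorems

namespace DrefuteG4

/-- Physical / similarity space `ℝ³`. -/
local notation "ℝ³" => EuclideanSpace ℝ (Fin 3)

variable {C a : ℝ} {u : ℝ → ℝ³ → ℝ³}

/-! ## The dynamic half: `Z_R` is differentiable and `Z_R' = −½Z + ½D + T + 2P + V − 2∫φ‖∇Ω‖²_F` -/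

section Dynamic

variable (hu : IsTypeIAncientMild C u)
include hu

-- adapted from Cruxes/MustSqueeze/NegativeNotes-g2-StubSignedBudgetProof.lean (namespace DrefuteG2)
/-- The similarity vorticity is jointly smooth in `(s, y)`. -/
theorem contDiff_uncurry_lerayVorticity : ContDiff ℝ ∞ (Function.uncurry (lerayVorticity u)) := by
  have hU : ContDiff ℝ ∞ (Function.uncurry (lerayOrbit u)) := contDiff_uncurry_lerayOrbit hu.1
  have hU' : ContDiff ℝ ∞ (Function.uncurry fun (p : ℝ × ℝ³) (q : ℝ³) => lerayOrbit u p.1 q) := by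
    have e : (Function.uncurry fun (p : ℝ × ℝ³) (q : ℝ³) => lerayOrbit u p.1 q) =
        Function.uncurry (lerayOrbit u) ∘ fun r : (ℝ × ℝ³) × ℝ³ => (r.1.1, r.2) := by
      funext r; rfl
    rw [e]
    exact hU.comp ((contDiff_fst.comp contDiff_fst).prodMk contDiff_snd)
  have hD : ContDiff ℝ ∞ fun p : ℝ × ℝ³ => fderiv ℝ (lerayOrbit u p.1) p.2 :=
    hU'.fderiv (m := ∞) (n := ∞) contDiff_snd (by simp)
  have e : Function.uncurry (lerayVorticity u) = fun p : ℝ × ℝ³ => curlCLM (fderiv ℝ (lerayOrbit u p.1) p.2) := by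
    funext p; rfl
  rw [e]
  exact curlCLM.contDiff.comp hD

/-- Joint smoothness in the `ContDiffOn … (univ ×ˢ univ)` form of `SpaceTimeCalculusC1`. -/
theorem contDiffOn_uncurry_lerayVorticity {n : ℕ∞} :
    ContDiffOn ℝ n (Function.uncurry (lerayVorticity u)) (univ ×ˢ univ) :=
  ((contDiff_uncurry_lerayVorticity hu).of_le (by exact_mod_cast le_top)).contDiffOn

/-- Slices of the similarity vorticity are smooth. -/
theorem contDiff_lerayVorticity_slice (s : ℝ) {n : ℕ∞} : ContDiff ℝ n (lerayVorticity u s) :=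
  contDiff_slice_of_contDiffOn (contDiffOn_uncurry_lerayVorticity hu) (mem_univ s)

/-- **The time derivative of the localised enstrophy**:
`Z_R'(s) = ∫ φ_R · 2⟪∂ₛΩ(s,·), Ω(s,·)⟫`, `∂ₛΩ = timeDerivWithin univ (lerayVorticity u)`. -/
theorem hasDerivAt_cutoffEnstrophy {R : ℝ} (hR : 0 < R) (s : ℝ) :
    HasDerivAt (fun σ => ∫ y, smoothTransition (2 - ‖y‖ ^ 2 / R ^ 2) * ‖lerayVorticity u σ y‖ ^ 2)
      (∫ y, smoothTransition (2 - ‖y‖ ^ 2 / R ^ 2) *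
        (2 * ⟪timeDerivWithin univ (lerayVorticity u) s y, lerayVorticity u s y⟫)) s := by
  have hφ : ContDiff ℝ 1 fun z : ℝ³ => smoothTransition (2 - ‖z‖ ^ 2 / R ^ 2) :=
    contDiff_smoothTransition_cutoff (n := 1) R
  have hΦ : ContDiffOn ℝ 1 (Function.uncurry fun (σ : ℝ) (y : ℝ³) =>
      smoothTransition (2 - ‖y‖ ^ 2 / R ^ 2) * ‖lerayVorticity u σ y‖ ^ 2) (univ ×ˢ univ) := by
    have h1 : ContDiff ℝ 1 fun p : ℝ × ℝ³ => smoothTransition (2 - ‖p.2‖ ^ 2 / R ^ 2) :=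
      hφ.comp contDiff_snd
    have h2 : ContDiff ℝ 1 fun p : ℝ × ℝ³ => ‖Function.uncurry (lerayVorticity u) p‖ ^ 2 :=
      ((contDiff_uncurry_lerayVorticity hu).of_le (by exact_mod_cast le_top)).norm_sq ℝ
    exact (h1.mul h2).contDiffOn
  have hsupp : ∀ t ∈ (univ : Set ℝ), ∀ y ∉ closedBall (0 : ℝ³) (2 * R),
      (fun (σ : ℝ) (y : ℝ³) => smoothTransition (2 - ‖y‖ ^ 2 / R ^ 2) * ‖lerayVorticity u σ y‖ ^ 2) t y = 0 := by
    intro t _ y hy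
    show smoothTransition (2 - ‖y‖ ^ 2 / R ^ 2) * ‖lerayVorticity u t y‖ ^ 2 = 0
    rw [smoothTransition_cutoff_eq_zero_of_notMem hR hy, zero_mul]
  have key := hasDerivAt_integral_of_contDiffOn (μ := (volume : Measure ℝ³)) isOpen_univ hΦ
    (isCompact_closedBall (0 : ℝ³) (2 * R)) hsupp (mem_univ s)
  have hΩ1 : ContDiffOn ℝ 1 (Function.uncurry (lerayVorticity u)) (univ ×ˢ univ) :=
    contDiffOn_uncurry_lerayVorticity hu (n := 1)
  have hpt : ∀ y, deriv (fun σ => smoothTransition (2 - ‖y‖ ^ 2 / R ^ 2) * ‖lerayVorticity u σ y‖ ^ 2) s =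
      smoothTransition (2 - ‖y‖ ^ 2 / R ^ 2) *
        (2 * ⟪timeDerivWithin univ (lerayVorticity u) s y, lerayVorticity u s y⟫) := by
    intro y
    have h1 := hasDerivAt_timeLine_timeDerivWithin hΩ1 univ_mem y (t := s)
    have h2 := (h1.norm_sq).const_mul (smoothTransition (2 - ‖y‖ ^ 2 / R ^ 2))
    rw [h2.deriv, real_inner_comm]
  have e : (fun y => deriv (fun σ => (fun (σ : ℝ) (y : ℝ³) =>
      smoothTransition (2 - ‖y‖ ^ 2 / R ^ 2) * ‖lerayVorticity u σ y‖ ^ 2) σ y) s) =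
      fun y => smoothTransition (2 - ‖y‖ ^ 2 / R ^ 2) *
        (2 * ⟪timeDerivWithin univ (lerayVorticity u) s y, lerayVorticity u s y⟫) :=
    funext hpt
  rw [e] at key
  exact key

omit hu in
/-- Inner-product bookkeeping for the five terms of the vorticity equation. -/
theorem inner_expand (c : ℝ) (a b w d e : ℝ³) :
    c * (2 * ⟪a + b - w - (1 / 2 : ℝ) • d - e, w⟫) =
      2 * (c * ⟪a, w⟫) + 2 * (c * ⟪b, w⟫) - 2 * (c * ⟪w, w⟫) - c * ⟪d, w⟫ - 2 * (c * ⟪e, w⟫) := by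
  rw [inner_sub_left, inner_sub_left, inner_sub_left, inner_add_left, real_inner_smul_left]
  ring

/-- **The enstrophy identity** at a fixed `s`, for any smooth compactly supported cutoff `φ`:
`∫ φ · 2⟪∂ₛΩ, Ω⟫ = −½∫φ‖Ω‖² + ½∫(y·∇φ)‖Ω‖² + ∫(U·∇φ)‖Ω‖² + 2∫φ⟪DUΩ,Ω⟫ + ∫‖Ω‖²Δφ − 2∫φ‖∇Ω‖²_F`. -/
theorem enstrophy_identity {φ : ℝ³ → ℝ} (hφ : ContDiff ℝ ∞ φ) (hφc : HasCompactSupport φ) (s : ℝ) :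
    (∫ y, φ y * (2 * ⟪timeDerivWithin univ (lerayVorticity u) s y, lerayVorticity u s y⟫)) =
      -(1 / 2) * (∫ y, φ y * ‖lerayVorticity u s y‖ ^ 2)
        + (1 / 2) * (∫ y, fderiv ℝ φ y y * ‖lerayVorticity u s y‖ ^ 2)
        + (∫ y, fderiv ℝ φ y (lerayOrbit u s y) * ‖lerayVorticity u s y‖ ^ 2)
        + 2 * (∫ y, φ y * ⟪fderiv ℝ (lerayOrbit u s) y (lerayVorticity u s y), lerayVorticity u s y⟫)
        + (∫ y, ‖lerayVorticity u s y‖ ^ 2 * (Δ φ) y)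
        - 2 * (∫ y, φ y * frobeniusNormSq (fderiv ℝ (lerayVorticity u s) y)) := by
  have hφcont : Continuous φ := hφ.continuous
  have hW : ContDiff ℝ ∞ (lerayVorticity u s) := contDiff_lerayVorticity_slice hu s (n := ⊤)
  have hU : ContDiff ℝ ∞ (lerayOrbit u s) := mustSqueeze_contDiff_lerayOrbit_slice hu s (n := ⊤)
  have hdiv : VectorCalculus.IsDivFree (lerayOrbit u s) :=
    (isDivFree_lerayOrbit_iff u s).2 (hu.isDivFree (neg_neg_of_pos (Real.exp_pos _)))
  have ibp1 := two_mul_integral_mul_inner_fderiv_self_self_eq (φ := φ) (W := lerayVorticity u s) hφ hφc hW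
  have ibp2 := two_mul_integral_mul_inner_convect_self_eq_of_isDivFree (φ := φ) (W := lerayVorticity u s)
    (V := lerayOrbit u s) hφ hφc hW hU hdiv
  have ibp3 := integral_mul_inner_laplacian_self_eq (φ := φ) (W := lerayVorticity u s) hφ hφc hW
  rw [finrank_euclideanSpace_fin] at ibp1
  simp only [Nat.cast_ofNat] at ibp1
  have hpde : ∀ y, timeDerivWithin univ (lerayVorticity u) s y =
      convect (lerayVorticity u s) (lerayOrbit u s) y + (Δ (lerayVorticity u s)) y - lerayVorticity u s y
        - (1 / 2 : ℝ) • fderiv ℝ (lerayVorticity u s) y y - convect (lerayOrbit u s) (lerayVorticity u s) y := by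
    intro y
    have h := hu.lerayVorticity_eq s y
    rw [← h]
    abel
  have hcW : Continuous (lerayVorticity u s) := hW.continuous
  have hcU : Continuous (lerayOrbit u s) := hU.continuous
  have hcDW : Continuous (fderiv ℝ (lerayVorticity u s)) :=
    (contDiff_lerayVorticity_slice hu s (n := 1)).continuous_fderiv one_ne_zero
  have hcDU : Continuous (fderiv ℝ (lerayOrbit u s)) :=
    (mustSqueeze_contDiff_lerayOrbit_slice hu s (n := 1)).continuous_fderiv one_ne_zero
  have hcΔ : Continuous (Δ (lerayVorticity u s)) :=
    continuous_laplacian (contDiff_lerayVorticity_slice hu s (n := 2))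
  have hc1 : Continuous fun y => ⟪convect (lerayVorticity u s) (lerayOrbit u s) y, lerayVorticity u s y⟫ := by
    have e : (fun y => convect (lerayVorticity u s) (lerayOrbit u s) y) =
        fun y => fderiv ℝ (lerayOrbit u s) y (lerayVorticity u s y) := by funext y; rfl
    have h : Continuous fun y => convect (lerayVorticity u s) (lerayOrbit u s) y := by
      rw [e]; exact hcDU.clm_apply hcW
    exact h.inner hcW
  have hc2 : Continuous fun y => ⟪(Δ (lerayVorticity u s)) y, lerayVorticity u s y⟫ := hcΔ.inner hcW
  have hc3 : Continuous fun y => ⟪lerayVorticity u s y, lerayVorticity u s y⟫ := hcW.inner hcW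
  have hc4 : Continuous fun y => ⟪fderiv ℝ (lerayVorticity u s) y y, lerayVorticity u s y⟫ :=
    (hcDW.clm_apply continuous_id).inner hcW
  have hc5 : Continuous fun y => ⟪convect (lerayOrbit u s) (lerayVorticity u s) y, lerayVorticity u s y⟫ := by
    have e : (fun y => convect (lerayOrbit u s) (lerayVorticity u s) y) =
        fun y => fderiv ℝ (lerayVorticity u s) y (lerayOrbit u s y) := by funext y; rfl
    have h : Continuous fun y => convect (lerayOrbit u s) (lerayVorticity u s) y := by
      rw [e]; exact hcDW.clm_apply hcU
    exact h.inner hcW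
  have i1 : Integrable fun y => φ y * ⟪convect (lerayVorticity u s) (lerayOrbit u s) y, lerayVorticity u s y⟫ :=
    (hφcont.mul hc1).integrable_of_hasCompactSupport hφc.mul_right
  have i2 : Integrable fun y => φ y * ⟪(Δ (lerayVorticity u s)) y, lerayVorticity u s y⟫ :=
    (hφcont.mul hc2).integrable_of_hasCompactSupport hφc.mul_right
  have i3 : Integrable fun y => φ y * ⟪lerayVorticity u s y, lerayVorticity u s y⟫ :=
    (hφcont.mul hc3).integrable_of_hasCompactSupport hφc.mul_right
  have i4 : Integrable fun y => φ y * ⟪fderiv ℝ (lerayVorticity u s) y y, lerayVorticity u s y⟫ :=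
    (hφcont.mul hc4).integrable_of_hasCompactSupport hφc.mul_right
  have i5 : Integrable fun y => φ y * ⟪convect (lerayOrbit u s) (lerayVorticity u s) y, lerayVorticity u s y⟫ :=
    (hφcont.mul hc5).integrable_of_hasCompactSupport hφc.mul_right
  have hpt : ∀ y, φ y * (2 * ⟪timeDerivWithin univ (lerayVorticity u) s y, lerayVorticity u s y⟫) =
      2 * (φ y * ⟪convect (lerayVorticity u s) (lerayOrbit u s) y, lerayVorticity u s y⟫)
        + 2 * (φ y * ⟪(Δ (lerayVorticity u s)) y, lerayVorticity u s y⟫)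
        - 2 * (φ y * ⟪lerayVorticity u s y, lerayVorticity u s y⟫)
        - φ y * ⟪fderiv ℝ (lerayVorticity u s) y y, lerayVorticity u s y⟫
        - 2 * (φ y * ⟪convect (lerayOrbit u s) (lerayVorticity u s) y, lerayVorticity u s y⟫) := by
    intro y
    rw [hpde y]
    exact inner_expand (φ y) _ _ _ _ _
  have hint : (∫ y, φ y * (2 * ⟪timeDerivWithin univ (lerayVorticity u) s y, lerayVorticity u s y⟫)) =
      2 * (∫ y, φ y * ⟪convect (lerayVorticity u s) (lerayOrbit u s) y, lerayVorticity u s y⟫)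
        + 2 * (∫ y, φ y * ⟪(Δ (lerayVorticity u s)) y, lerayVorticity u s y⟫)
        - 2 * (∫ y, φ y * ⟪lerayVorticity u s y, lerayVorticity u s y⟫)
        - (∫ y, φ y * ⟪fderiv ℝ (lerayVorticity u s) y y, lerayVorticity u s y⟫)
        - 2 * (∫ y, φ y * ⟪convect (lerayOrbit u s) (lerayVorticity u s) y, lerayVorticity u s y⟫) := by
    rw [integral_congr_ae (Eventually.of_forall hpt)]
    rw [integral_sub, integral_sub, integral_sub, integral_add, integral_const_mul, integral_const_mul,
      integral_const_mul, integral_const_mul]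
    · exact i1.const_mul 2
    · exact i2.const_mul 2
    · exact (i1.const_mul 2).add (i2.const_mul 2)
    · exact i3.const_mul 2
    · exact ((i1.const_mul 2).add (i2.const_mul 2)).sub (i3.const_mul 2)
    · exact i4
    · exact (((i1.const_mul 2).add (i2.const_mul 2)).sub (i3.const_mul 2)).sub i4
    · exact i5.const_mul 2
  have e1 : (∫ y, φ y * ⟪convect (lerayVorticity u s) (lerayOrbit u s) y, lerayVorticity u s y⟫) =
      ∫ y, φ y * ⟪fderiv ℝ (lerayOrbit u s) y (lerayVorticity u s y), lerayVorticity u s y⟫ := by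
    rfl
  have e3 : (∫ y, φ y * ⟪lerayVorticity u s y, lerayVorticity u s y⟫) = ∫ y, φ y * ‖lerayVorticity u s y‖ ^ 2 := by
    refine integral_congr_ae (Eventually.of_forall fun y => ?_)
    show φ y * ⟪lerayVorticity u s y, lerayVorticity u s y⟫ = φ y * ‖lerayVorticity u s y‖ ^ 2
    rw [real_inner_self_eq_norm_sq]
  rw [hint, e1, e3]
  linarith [ibp1, ibp2, ibp3]

/-- **`deriv Z_R`**, assembled: `Z_R' = −½Z + ½D + T + 2P + V − 2∫φ‖∇Ω‖²_F`. -/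
theorem deriv_cutoffEnstrophy_eq {R : ℝ} (hR : 0 < R) (s : ℝ) :
    deriv (fun σ => ∫ y, smoothTransition (2 - ‖y‖ ^ 2 / R ^ 2) * ‖lerayVorticity u σ y‖ ^ 2) s =
      -(1 / 2) * (∫ y, smoothTransition (2 - ‖y‖ ^ 2 / R ^ 2) * ‖lerayVorticity u s y‖ ^ 2)
        + (1 / 2) * (∫ y, fderiv ℝ (fun z : ℝ³ => smoothTransition (2 - ‖z‖ ^ 2 / R ^ 2)) y y *
            ‖lerayVorticity u s y‖ ^ 2)
        + (∫ y, fderiv ℝ (fun z : ℝ³ => smoothTransition (2 - ‖z‖ ^ 2 / R ^ 2)) y (lerayOrbit u s y) *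
            ‖lerayVorticity u s y‖ ^ 2)
        + 2 * (∫ y, smoothTransition (2 - ‖y‖ ^ 2 / R ^ 2) *
            ⟪fderiv ℝ (lerayOrbit u s) y (lerayVorticity u s y), lerayVorticity u s y⟫)
        + (∫ y, ‖lerayVorticity u s y‖ ^ 2 *
            (Δ (fun z : ℝ³ => smoothTransition (2 - ‖z‖ ^ 2 / R ^ 2))) y)
        - 2 * (∫ y, smoothTransition (2 - ‖y‖ ^ 2 / R ^ 2) *
            frobeniusNormSq (fderiv ℝ (lerayVorticity u s) y)) := by
  rw [(hasDerivAt_cutoffEnstrophy hu hR s).deriv]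
  exact enstrophy_identity hu (contDiff_smoothTransition_cutoff (n := ⊤) R)
    (hasCompactSupport_smoothTransition_cutoff hR) s

end Dynamic

end DrefuteG4

/-! ## The lever, verbatim, from the TREE's static part + the dynamic half above -/

section Verbatim

open MeasureTheory Set Filter Topology
open scoped RealInnerProductSpace
open Literature.Analysis.FluidPDE
open Summit.NavierStokesRegularity.NavierStokesRegularity.Theses.SqueezeCycle

/-- Physical / similarity space `ℝ³`. -/
local notation "ℝ³" => EuclideanSpace ℝ (Fin 3)

/-- **stub_signedBudget** (skeleton v1 sha 75fd2eb7, VERBATIM) from the tree's landed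
`stub_signedBudgetStatic` (p74592) and `DrefuteG4.hasDerivAt_cutoffEnstrophy` /
`DrefuteG4.deriv_cutoffEnstrophy_eq` (drop `−2∫φ_R‖∇Ω‖²_F ≤ 0`). -/
theorem stub_signedBudget_g4 : ∀ (C a κ' : ℝ) (u : ℝ → ℝ³ → ℝ³), IsTypeIAncientMild C u →
    (∀ t < 0, ∀ x, lerayMiddleStrain u t x ≤ a) → 0 ≤ a →
    (∀ (s : ℝ) (y : ℝ³), ‖lerayOrbit u s y‖ ≤ C) →
    (∀ ρ : ℝ, 0 < ρ →
      Continuous fun s => ∫ y in Metric.ball (0 : ℝ³) ρ, frobeniusNormSq (fderiv ℝ (lerayOrbit u s) y)) →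
    (∀ (R s : ℝ), 1 ≤ R →
      (∫ y, Real.smoothTransition (2 - ‖y‖ ^ 2 / R ^ 2) * frobeniusNormSq (fderiv ℝ (lerayOrbit u s) y)) ≤
        (∫ y, Real.smoothTransition (2 - ‖y‖ ^ 2 / R ^ 2) * ‖lerayVorticity u s y‖ ^ 2) +
          κ' * Real.sqrt ((∫ y in Metric.ball (0 : ℝ³) (2 * R),
            frobeniusNormSq (fderiv ℝ (lerayOrbit u s) y)) / R)) →
    ∃ κ : ℝ, ∀ R : ℝ, 1 ≤ R →
      Differentiable ℝ (fun s => ∫ y, Real.smoothTransition (2 - ‖y‖ ^ 2 / R ^ 2) * ‖lerayVorticity u s y‖ ^ 2) ∧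
      ∃ K : ℝ → ℝ, Continuous K ∧ (∀ s, 0 ≤ K s) ∧
        (∀ s, K s ≤ κ * ((∫ y in Metric.ball (0 : ℝ³) (2 * R), frobeniusNormSq (fderiv ℝ (lerayOrbit u s) y)) / R +
          Real.sqrt ((∫ y in Metric.ball (0 : ℝ³) (2 * R), frobeniusNormSq (fderiv ℝ (lerayOrbit u s) y)) / R))) ∧
        ∀ s, deriv (fun s => ∫ y, Real.smoothTransition (2 - ‖y‖ ^ 2 / R ^ 2) * ‖lerayVorticity u s y‖ ^ 2) s ≤
          -(2 * (1 / 4 - a)) * (∫ y, Real.smoothTransition (2 - ‖y‖ ^ 2 / R ^ 2) * ‖lerayVorticity u s y‖ ^ 2) + K s := by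
  intro C a κ' u hu hΛ ha hUC hEcont hcmp
  obtain ⟨κ, hκ⟩ := stub_signedBudgetStatic C a κ' u hu hΛ ha hUC hEcont hcmp
  refine ⟨κ, fun R hR1 => ?_⟩
  have hR : 0 < R := lt_of_lt_of_le one_pos hR1
  obtain ⟨K, hKc, hK0, hKle, hmain⟩ := hκ R hR1
  refine ⟨fun s => (DrefuteG4.hasDerivAt_cutoffEnstrophy hu hR s).differentiableAt, K, hKc, hK0, hKle,
    fun s => ?_⟩
  rw [DrefuteG4.deriv_cutoffEnstrophy_eq hu hR s]
  have hdiss : 0 ≤ ∫ y, Real.smoothTransition (2 - ‖y‖ ^ 2 / R ^ 2) *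
      frobeniusNormSq (fderiv ℝ (lerayVorticity u s) y) :=
    integral_nonneg fun y => mul_nonneg (smoothTransition_cutoff_nonneg R y) (frobeniusNormSq_nonneg _)
  linarith [hmain s]

/-! ## Composition: the skeleton's `MustSqueeze_of`, stubs resolved BY NAME to the tree -/

/-- **`MustSqueeze` from the tree's landed stubs + `stub_signedBudget_g4`** — the skeleton's
`MustSqueeze_of` proof script verbatim (only `stub_signedBudget ↦ stub_signedBudget_g4`). -/
theorem MustSqueeze_of_g4 :
    Summit.NavierStokesRegularity.NavierStokesRegularity.Theses.SqueezeCycle.MustSqueeze := by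
  intro C u hu h6
  obtain ⟨h1, h2, h3, h4, h5⟩ := hu
  -- the inline class is the tree's Type-I KNSS-mild class
  have hK : IsTypeIAncientMild C u := isTypeIAncientMild_of_squeezeClass h1 h2 h3 h4
  -- H6 is `Λ ≤ 1/8` (Courant–Fischer)
  have hΛ : ∀ t < 0, ∀ x, lerayMiddleStrain u t x ≤ 1 / 8 := fun t ht x =>
    (lerayMiddleStrain_le_iff ht (1 / 8)).2 (h6 t ht x)
  -- the stubs
  obtain ⟨hUle, hMorrey⟩ := stub_simDictionary C u hK h5
  obtain ⟨hE0, hEcont, hEmono⟩ := stub_gradEnergyBasic C u hK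
  have hEavg := stub_gradEnergyAverage C u hK h5 hEcont
  obtain ⟨κ', hdc⟩ := stub_divCurlBalls C u hK hMorrey
  obtain ⟨κ, hbudget⟩ := stub_signedBudget_g4 C (1 / 8) κ' u hK hΛ (by norm_num) hUle hEcont
    (fun R s hR => (hdc R s hR).2.1)
  -- abstract two-pass Grönwall
  set Z : ℝ → ℝ → ℝ := fun R s =>
    ∫ y, Real.smoothTransition (2 - ‖y‖ ^ 2 / R ^ 2) * ‖lerayVorticity u s y‖ ^ 2 with hZ
  set E : ℝ → ℝ → ℝ := fun ρ s =>
    ∫ y in Metric.ball (0 : ℝ³) ρ, frobeniusNormSq (fderiv ℝ (lerayOrbit u s) y) with hE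
  have hc : (0 : ℝ) < 2 * (1 / 4 - 1 / 8) := by norm_num
  have hZ0 : ∀ R s : ℝ, 1 ≤ R → 0 ≤ Z R s := fun R s _ =>
    integral_nonneg fun y => mul_nonneg (Real.smoothTransition.nonneg _) (sq_nonneg _)
  have hbudget' : ∀ R : ℝ, 1 ≤ R → Differentiable ℝ (Z R) ∧ ∃ K : ℝ → ℝ, Continuous K ∧
      (∀ s, 0 ≤ K s) ∧ (∀ s, K s ≤ κ * (E (2 * R) s / R + Real.sqrt (E (2 * R) s / R))) ∧
      ∀ s, deriv (Z R) s ≤ -(2 * (1 / 4 - 1 / 8)) * Z R s + K s := fun R hR => hbudget R hR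
  have hvan : ∀ ρ s : ℝ, 0 < ρ → E ρ s = 0 :=
    stub_twoPassGronwall (2 * (1 / 4 - 1 / 8)) κ κ' (6 * C) Z E hc hE0 hEcont hEmono hEavg hbudget'
      hZ0 (fun R R' s hR hRR' => (hdc R s hR).2.2.2 R' hRR') (fun R s hR => (hdc R s hR).1)
      (fun R s hR => ((hdc R s hR).2.2.1).trans ((hdc R s hR).2.1))
  exact stub_endgame C u hK hMorrey hvan

end Verbatim

end Summit.NavierStokesRegularity.NavierStokesRegularity.Theorems

end
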